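import Literature.Analysis.Calculus.BorderedImplicitFamily

/-!
# Second-order information at a simply degenerate zero of a quadratic map: the cokernel
# functional, the exact reduced identity, and robust crossing at a transversal fold
# (Chow–Hale 1982, Ch. 6; Kielhöfer 2012, §I.4–I.5; Vanderbauwhede 1982, Ch. 8)

Analysis/Calculus proof file (Mathlib only; theorems only, no definitions, no named facts).
Companion of `Literature.Analysis.Calculus.BorderedImplicitFamily`: there the bordered implicit
function theorem produces, at a zero `u₀` of `u ↦ N u + frc c` whose bordered operator
`(w, t) ↦ (T w − t e, φ w)` is bijective (`T = DN(u₀)`, `e ∉ range T`), the two-parameter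
Lyapunov–Schmidt family `(c', x) ↦ (υ (c', x), σ (c', x))` solving
`N (υ q) + frc q.1 − σ q • e = 0`.  Here we supply the SECOND-ORDER information on the scalar
reduced ("bifurcation") function `σ` when `N` is exactly quadratic, `N u = A u + B u u` with `A`
continuous linear and `B` continuous bilinear (the case of the steady Navier–Stokes map), so that
`N (u₀ + z) = N u₀ + T z + B z z` with `T = A + B u₀ + B · u₀` holds WITHOUT remainder.

* `exists_cokernel_functional` — from the bordered inverse `M = ((w, t) ↦ (T w − t e, φ w))⁻¹`
  one reads off the cokernel functional `ψ y := −(M⁻¹ (y, 0)).2`: `ψ ∘ T = 0`, `ψ e = 1`, and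
  `ψ y = 0 ⇒ y ∈ range T` (so `ker ψ = range T`, `Y = range T ⊕ ℝ e`).
* `quadratic_expansion`, `reduced_identity` — the exact Lyapunov–Schmidt identity: every
  solution of `A u + B u u + frc c' − s • e = 0` satisfies
  `s = ψ (B (u − u₀) (u − u₀)) + ψ (frc (c' − c))` (apply `ψ` to the difference with the base
  equation `A u₀ + B u₀ u₀ + frc c = 0`; the linear term `T (u − u₀)` is killed by `ψ`).
* `tendsto_lineSlope` — difference quotients of a Fréchet differentiable map along a line.
* `robustCrossing_of_fold_of_mul_neg`, `robustCrossing_of_fold` — ROBUST CROSSING AT A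
  TRANSVERSAL FOLD (the saddle-node / turning point of Kielhöfer 2012 §I.4–I.5, Chow–Hale 1982
  Ch. 6): if the quadratic coefficient of the reduced function along the kernel direction
  `g₁ = Dυ (0, 1)` is nonzero, `a = ψ (B g₁ g₁) ≠ 0` (a fold), and one parameter direction `d` is
  visible at first order, `b = ψ (frc d) ≠ 0`, then for every `η > 0` there are `s` with
  `dist (c + s d) c < η` and `|x₁|, |x₂| < η` inside the ball of the family with
  `σ (c + s d, x₁) < 0 < σ (c + s d, x₂)`: the reduced function changes sign in the kernel
  coordinate at parameters arbitrarily close to `c`, with NO isolation and NO symmetry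
  hypothesis.  Proof: by the reduced identity `σ (c, x) = ψ (B z z)` with
  `z = υ (c, x) − u₀ = x g₁ + o(x)`, so `σ (c, x) / x² → a` (blow-up `x⁻¹ z → g₁` and continuity of
  the quadratic form); by continuity of `σ` at the interior point `(c, x₂)` the sign of `a`
  persists at `(c + s d, x₂)` for small `s`; and `σ (c + s d, 0) = ψ (B z z) + s b` with
  `z = υ (c + s d, 0) − u₀ = O(s)`, so `σ (c + s d, 0) / s → b`.  Normalising the direction `d`
  so that `a b < 0` and taking `s > 0` small, `σ (c + s d, 0)` and `σ (c + s d, x₂)` have opposite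
  signs.

Not here: the Navier–Stokes instantiation (summit side), higher kernel dimension, the cusp and
higher degeneracies, differentiability of `σ` beyond the base point.

## References

* S.-N. Chow, J. K. Hale, *Methods of Bifurcation Theory*, Grundlehren 251, Springer (1982),
  Ch. 6 (static bifurcation with one-dimensional kernel, the saddle-node). [ChowHale1982]
* H. Kielhöfer, *Bifurcation Theory. An Introduction with Applications to Partial Differential
  Equations*, 2nd ed., Applied Mathematical Sciences 156, Springer (2012), §I.4–I.5 (turning
  points / saddle-node bifurcation via the Lyapunov–Schmidt reduction). [Kielhofer2012]
* A. Vanderbauwhede, *Local Bifurcation and Symmetry*, Research Notes in Mathematics 75, Pitman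
  (1982), Ch. 8. [Vanderbauwhede1982]
-/

noncomputable section

open scoped Topology
open Filter Set Function

namespace Literature.Analysis.Calculus

section SecondOrder

variable {X Y : Type*} [NormedAddCommGroup X] [NormedSpace ℝ X]
  [NormedAddCommGroup Y] [NormedSpace ℝ Y]
  {P : Type*} [NormedAddCommGroup P] [NormedSpace ℝ P]

/-! ## The cokernel functional from the bordered inverse -/

/-- **The cokernel functional** (Chow–Hale 1982 §2.4, bordered operators).  If the bordered
operator `(w, t) ↦ (T w − t e, φ w)` is bijective `X × ℝ → Y × ℝ` (Banach spaces) and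
`e ∉ range T`, then `ψ y := −(M⁻¹ (y, 0)).2` (`M` the bordered operator) is a continuous linear
functional with `ψ ∘ T = 0`, `ψ e = 1` and `ker ψ ⊆ range T`. [folklore] -/
theorem exists_cokernel_functional [CompleteSpace X] [CompleteSpace Y] (T : X →L[ℝ] Y)
    (φ : X →L[ℝ] ℝ) (e : Y)
    (hD : Function.Bijective fun p : X × ℝ => (T p.1 - p.2 • e, φ p.1)) (he : ∀ w : X, T w ≠ e) :
    ∃ ψ : Y →L[ℝ] ℝ, (∀ w : X, ψ (T w) = 0) ∧ ψ e = 1 ∧ ∀ y : Y, ψ y = 0 → ∃ w : X, T w = y := by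
  -- the bordered operator as a continuous linear equivalence `M`
  set L : X × ℝ →L[ℝ] Y × ℝ :=
    (T.comp (ContinuousLinearMap.fst ℝ X ℝ) - (ContinuousLinearMap.snd ℝ X ℝ).smulRight e).prod
      (φ.comp (ContinuousLinearMap.fst ℝ X ℝ)) with hL
  have hLp : ∀ p : X × ℝ, L p = (T p.1 - p.2 • e, φ p.1) := fun p => by
    simp [hL, sub_eq_add_neg]
  have hb : Bijective L := by
    have h : (⇑L : X × ℝ → Y × ℝ) = fun p : X × ℝ => (T p.1 - p.2 • e, φ p.1) := funext hLp
    rw [h]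
    exact hD
  set M : (X × ℝ) ≃L[ℝ] Y × ℝ := ContinuousLinearEquiv.ofBijective L
    (LinearMap.ker_eq_bot.2 hb.1) (LinearMap.range_eq_top.2 hb.2)
  have hMp : ∀ p : X × ℝ, M p = (T p.1 - p.2 • e, φ p.1) := fun p => hLp p
  -- `M.symm (y, 0) = (w, t)` means `T w - t • e = y` and `φ w = 0`
  have hsy : ∀ y : Y,
      T (M.symm (y, 0)).1 - (M.symm (y, 0)).2 • e = y ∧ φ (M.symm (y, 0)).1 = 0 := by
    intro y
    have h := M.apply_symm_apply (y, 0)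
    rw [hMp, Prod.mk.injEq] at h
    exact h
  -- `T w = t • e` forces `t = 0` since `e ∉ range T`
  have hsm : ∀ (w : X) (t : ℝ), T w = t • e → t = 0 := fun w t h => by
    by_contra ht
    exact he (t⁻¹ • w) (by rw [map_smul, h, smul_smul, inv_mul_cancel₀ ht, one_smul])
  refine ⟨-((ContinuousLinearMap.snd ℝ X ℝ).comp
      ((M.symm : Y × ℝ →L[ℝ] X × ℝ).comp (ContinuousLinearMap.inl ℝ Y ℝ))), ?_, ?_, ?_⟩
  · intro w'
    obtain ⟨h1, -⟩ := hsy (T w')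
    have h3 : T ((M.symm (T w', 0)).1 - w') = (M.symm (T w', 0)).2 • e := by
      rw [map_sub, sub_eq_iff_eq_add, ← sub_eq_iff_eq_add', h1]
    have ht : (M.symm (T w', 0)).2 = 0 := hsm _ _ h3
    simp [ht]
  · have h : M ((0 : X), (-1 : ℝ)) = (e, 0) := by rw [hMp]; simp
    have h' : M.symm (e, 0) = ((0 : X), (-1 : ℝ)) := by rw [← h, M.symm_apply_apply]
    simp [h']
  · intro y hy
    obtain ⟨h1, -⟩ := hsy y
    have ht : (M.symm (y, 0)).2 = 0 := by simpa using hy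
    refine ⟨(M.symm (y, 0)).1, ?_⟩
    rwa [ht, zero_smul, sub_zero] at h1

/-! ## The exact reduced identity for a quadratic map -/

/-- Exact second-order expansion of the quadratic map `N u = A u + B u u` around `u₀`:
`N (u₀ + z) = N u₀ + T z + B z z` for `T = A + B u₀ + B · u₀`. [folklore] -/
theorem quadratic_expansion (A : X →L[ℝ] Y) (B : X →L[ℝ] X →L[ℝ] Y) (T : X →L[ℝ] Y) (u₀ z : X)
    (hT : ∀ w, T w = A w + B u₀ w + B w u₀) :
    A (u₀ + z) + B (u₀ + z) (u₀ + z) = (A u₀ + B u₀ u₀) + T z + B z z := by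
  simp only [hT, map_add, add_apply]
  abel

/-- **The exact Lyapunov–Schmidt identity for a quadratic map** (Kielhöfer 2012 §I.2, §I.4;
Chow–Hale 1982 Ch. 6).  Let `N u = A u + B u u`, `T = A + B u₀ + B · u₀` its linearisation at
`u₀`, `ψ` a functional with `ψ ∘ T = 0`, `ψ e = 1`, and `N u₀ + frc c = 0`.  Then every solution
of `N u + frc q.1 − s • e = 0` satisfies `s = ψ (B (u − u₀) (u − u₀)) + ψ (frc (q.1 − c))`: the
reduced function is EXACTLY the quadratic form of `B` seen through `ψ`, plus the forcing.
[folklore] -/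
theorem reduced_identity (A : X →L[ℝ] Y) (B : X →L[ℝ] X →L[ℝ] Y) (T : X →L[ℝ] Y)
    (frc : P →L[ℝ] Y) (u₀ : X) (c : P) (e : Y) (ψ : Y →L[ℝ] ℝ)
    (hT : ∀ w, T w = A w + B u₀ w + B w u₀) (hψT : ∀ w, ψ (T w) = 0) (hψe : ψ e = 1)
    (h0 : A u₀ + B u₀ u₀ + frc c = 0) {q : P × ℝ} {u : X} {s : ℝ}
    (hsol : A u + B u u + frc q.1 - s • e = 0) :
    s = ψ (B (u - u₀) (u - u₀)) + ψ (frc (q.1 - c)) := by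
  have key : A u + B u u = (A u₀ + B u₀ u₀) + T (u - u₀) + B (u - u₀) (u - u₀) := by
    have h := quadratic_expansion A B T u₀ (u - u₀) hT
    rwa [add_sub_cancel] at h
  have h1 : T (u - u₀) + B (u - u₀) (u - u₀) + frc (q.1 - c) - s • e =
      (A u + B u u + frc q.1 - s • e) - (A u₀ + B u₀ u₀ + frc c) := by
    rw [key, frc.map_sub]
    abel
  rw [hsol, h0, sub_zero] at h1
  have h2 : ψ (T (u - u₀) + B (u - u₀) (u - u₀) + frc (q.1 - c) - s • e) = 0 := by
    rw [h1, map_zero]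
  rw [ψ.map_sub, ψ.map_add, ψ.map_add, hψT, ψ.map_smul, hψe, smul_eq_mul, mul_one,
    zero_add] at h2
  linarith

/-! ## Robust crossing at a transversal fold -/

/-- Difference quotients of a Fréchet differentiable map along the line `t ↦ p + t • v` converge
to the derivative in the direction `v` (punctured neighbourhood of `t = 0`). [folklore] -/
theorem tendsto_lineSlope {E F : Type*} [NormedAddCommGroup E] [NormedSpace ℝ E]
    [NormedAddCommGroup F] [NormedSpace ℝ F] {f : E → F} {f' : E →L[ℝ] F} {p : E}
    (hf : HasFDerivAt f f' p) (v : E) :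
    Tendsto (fun t : ℝ => t⁻¹ • (f (p + t • v) - f p)) (𝓝[≠] 0) (𝓝 (f' v)) := by
  have hl : HasDerivAt (fun t : ℝ => p + t • v) v 0 := by
    simpa using ((hasDerivAt_id (0 : ℝ)).smul_const v).const_add p
  have hf' : HasFDerivAt f f' (p + (0 : ℝ) • v) := by simpa using hf
  simpa using (hf'.comp_hasDerivAt (0 : ℝ) hl).tendsto_slope_zero

/-- **Robust crossing at a transversal fold, normalised signs** (Kielhöfer 2012 §I.4–I.5;
Chow–Hale 1982 Ch. 6).  The case `a · b < 0` of `robustCrossing_of_fold`, where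
`a = ψ (B g₁ g₁)`, `g₁ = Dυ (0, 1)` is the fold coefficient and `b = ψ (frc d)` the first-order
visibility of the direction `d`: for every `η > 0` there are `s > 0` and `ξ` with
`dist (c + s d) c < η`, `|ξ| < η`, both `(c + s d, 0)` and `(c + s d, ξ)` in the ball of the
family, `a · σ (c + s d, 0) < 0` and `0 < a · σ (c + s d, ξ)`. [folklore] -/
theorem robustCrossing_of_fold_of_mul_neg (A : X →L[ℝ] Y) (B : X →L[ℝ] X →L[ℝ] Y)
    (T : X →L[ℝ] Y) (frc : P →L[ℝ] Y) (u₀ : X) (c d : P) (e : Y) (ψ : Y →L[ℝ] ℝ)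
    (σ : P × ℝ → ℝ) (υ : P × ℝ → X) (Dυ : P × ℝ →L[ℝ] X) (r : ℝ)
    (hT : ∀ w, T w = A w + B u₀ w + B w u₀) (hψT : ∀ w, ψ (T w) = 0) (hψe : ψ e = 1)
    (h0 : A u₀ + B u₀ u₀ + frc c = 0) (hr : 0 < r) (hυ0 : υ (c, 0) = u₀)
    (hυd : HasFDerivAt υ Dυ (c, 0)) (hσc : ContinuousOn σ (Metric.ball ((c, 0) : P × ℝ) r))
    (hsol : ∀ q ∈ Metric.ball ((c, 0) : P × ℝ) r,
      A (υ q) + B (υ q) (υ q) + frc q.1 - σ q • e = 0)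
    (hab : ψ (B (Dυ (0, 1)) (Dυ (0, 1))) * ψ (frc d) < 0) {η : ℝ} (hη : 0 < η) :
    ∃ s ξ : ℝ, 0 < s ∧ dist (c + s • d) c < η ∧ |ξ| < η ∧
      ((c + s • d, 0) : P × ℝ) ∈ Metric.ball ((c, 0) : P × ℝ) r ∧
      ((c + s • d, ξ) : P × ℝ) ∈ Metric.ball ((c, 0) : P × ℝ) r ∧
      ψ (B (Dυ (0, 1)) (Dυ (0, 1))) * σ (c + s • d, 0) < 0 ∧
      0 < ψ (B (Dυ (0, 1)) (Dυ (0, 1))) * σ (c + s • d, ξ) := by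
  have ha : ψ (B (Dυ (0, 1)) (Dυ (0, 1))) ≠ 0 := left_ne_zero_of_mul hab.ne
  have hb : ψ (frc d) ≠ 0 := right_ne_zero_of_mul hab.ne
  -- the reduced identity on the ball, for points written as pairs
  have hred : ∀ (c' : P) (x : ℝ), ((c', x) : P × ℝ) ∈ Metric.ball ((c, 0) : P × ℝ) r →
      σ (c', x) = ψ (B (υ (c', x) - u₀) (υ (c', x) - u₀)) + ψ (frc (c' - c)) :=
    fun c' x hq => reduced_identity A B T frc u₀ c e ψ hT hψT hψe h0 (hsol (c', x) hq)
  -- the quadratic form `w ↦ ψ (B w w)`: homogeneity and continuity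
  have hQsmul : ∀ (t : ℝ) (w : X), ψ (B (t • w) (t • w)) = t ^ 2 * ψ (B w w) := by
    intro t w
    rw [B.map_smul₂, (B w).map_smul, smul_smul, ψ.map_smul, smul_eq_mul, sq]
  have hQc : Continuous fun w : X => ψ (B w w) :=
    ψ.continuous.comp (B.continuous.clm_apply continuous_id)
  -- membership in the product ball
  have hball : ∀ (c' : P) (x : ℝ), dist c' c < r → |x| < r →
      ((c', x) : P × ℝ) ∈ Metric.ball ((c, 0) : P × ℝ) r := fun c' x h1 h2 => by
    rw [Metric.mem_ball, Prod.dist_eq]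
    show max (dist c' c) (dist x 0) < r
    rw [Real.dist_0_eq_abs]
    exact max_lt h1 h2
  -- STEP 1 (fold direction): the blow-up `x⁻¹ • (υ (c, x) - u₀) → g₁` and `σ (c, x) = x² Q(⋯)`
  have hsl₁ : Tendsto (fun x : ℝ => x⁻¹ • (υ (c, x) - u₀)) (𝓝[≠] 0) (𝓝 (Dυ (0, 1))) := by
    simpa [hυ0] using tendsto_lineSlope hυd ((0 : P), (1 : ℝ))
  have hE₁ : ∀ᶠ x in 𝓝[≠] (0 : ℝ), 0 < ψ (B (Dυ (0, 1)) (Dυ (0, 1))) *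
      ψ (B (x⁻¹ • (υ (c, x) - u₀)) (x⁻¹ • (υ (c, x) - u₀))) :=
    (((hQc.tendsto _).comp hsl₁).const_mul _).eventually_const_lt (mul_self_pos.2 ha)
  have hE₁' : ∀ᶠ x in 𝓝[≠] (0 : ℝ), |x| < min η (r / 2) := by
    have h : ∀ᶠ x in 𝓝 (0 : ℝ), |x - 0| < min η (r / 2) :=
      eventually_abs_sub_lt 0 (lt_min hη (half_pos hr))
    simp only [sub_zero] at h
    exact h.filter_mono nhdsWithin_le_nhds
  obtain ⟨ξ, ⟨hξpos, hξlt⟩, hξne⟩ :=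
    ((hE₁.and hE₁').and (self_mem_nhdsWithin : ({0}ᶜ : Set ℝ) ∈ 𝓝[≠] (0 : ℝ))).exists
  have hξ0 : ξ ≠ 0 := Set.mem_compl_singleton_iff.1 hξne
  have hξη : |ξ| < η := lt_of_lt_of_le hξlt (min_le_left _ _)
  have hξr : |ξ| < r / 2 := lt_of_lt_of_le hξlt (min_le_right _ _)
  have hmemξ : ((c, ξ) : P × ℝ) ∈ Metric.ball ((c, 0) : P × ℝ) r :=
    hball c ξ (by rw [dist_self]; exact hr) (by linarith)
  have hσξ : 0 < ψ (B (Dυ (0, 1)) (Dυ (0, 1))) * σ (c, ξ) := by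
    rw [hred c ξ hmemξ, sub_self, frc.map_zero, ψ.map_zero, add_zero]
    have hz : υ (c, ξ) - u₀ = ξ • (ξ⁻¹ • (υ (c, ξ) - u₀)) := by
      rw [smul_smul, mul_inv_cancel₀ hξ0, one_smul]
    rw [hz, hQsmul, mul_left_comm]
    exact mul_pos (by positivity) hξpos
  -- STEP 2 (continuity in the parameter at the interior point `(c, ξ)`)
  have hpath : Tendsto (fun s : ℝ => ((c + s • d, ξ) : P × ℝ)) (𝓝 0) (𝓝 (c, ξ)) :=
    (by fun_prop : Continuous fun s : ℝ => ((c + s • d, ξ) : P × ℝ)).tendsto' 0 (c, ξ) (by simp)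
  have hE₂ : ∀ᶠ s in 𝓝 (0 : ℝ), 0 < ψ (B (Dυ (0, 1)) (Dυ (0, 1))) * σ (c + s • d, ξ) :=
    (((hσc.continuousAt (Metric.isOpen_ball.mem_nhds hmemξ)).tendsto.comp hpath).const_mul
      _).eventually_const_lt hσξ
  have hE₂' : ∀ᶠ s in 𝓝 (0 : ℝ), ((c + s • d, ξ) : P × ℝ) ∈ Metric.ball ((c, 0) : P × ℝ) r :=
    hpath.eventually_mem (Metric.isOpen_ball.mem_nhds hmemξ)
  -- STEP 3 (unfolding direction): `σ (c + s • d, 0) = s (s Q(⋯) + b)` with `Q(⋯)` convergent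
  have hsl₂ : Tendsto (fun s : ℝ => s⁻¹ • (υ (c + s • d, 0) - u₀)) (𝓝[≠] 0)
      (𝓝 (Dυ (d, 0))) := by
    simpa [hυ0] using tendsto_lineSlope hυd (d, (0 : ℝ))
  have hE₃ : ∀ᶠ s in 𝓝[≠] (0 : ℝ), 0 < ψ (frc d) *
      (s * ψ (B (s⁻¹ • (υ (c + s • d, 0) - u₀)) (s⁻¹ • (υ (c + s • d, 0) - u₀))) + ψ (frc d)) := by
    have h1 : Tendsto (fun s : ℝ => s) (𝓝[≠] (0 : ℝ)) (𝓝 0) :=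
      tendsto_id.mono_left nhdsWithin_le_nhds
    refine (((h1.mul ((hQc.tendsto _).comp hsl₂)).add_const _).const_mul
      _).eventually_const_lt ?_
    rw [zero_mul, zero_add]
    exact mul_self_pos.2 hb
  have hE₃' : ∀ᶠ s in 𝓝 (0 : ℝ), ‖s • d‖ < min η r :=
    (((continuous_id.smul continuous_const).norm).tendsto' (0 : ℝ) 0
      (by simp)).eventually_lt_const (lt_min hη hr)
  -- choose `s > 0` in all the ranges
  obtain ⟨s, ⟨⟨⟨hs₂, hs₂'⟩, hs₃⟩, hs₃'⟩, hs0⟩ :=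
    (((((hE₂.and hE₂').filter_mono nhdsWithin_le_nhds).and
      (hE₃.filter_mono (nhdsGT_le_nhdsNE 0))).and (hE₃'.filter_mono nhdsWithin_le_nhds)).and
      (self_mem_nhdsWithin : Set.Ioi (0 : ℝ) ∈ 𝓝[>] (0 : ℝ))).exists
  have hs : 0 < s := hs0
  have hsη : ‖s • d‖ < η := lt_of_lt_of_le hs₃' (min_le_left _ _)
  have hsr : ‖s • d‖ < r := lt_of_lt_of_le hs₃' (min_le_right _ _)
  have hdist : dist (c + s • d) c = ‖s • d‖ := by rw [dist_eq_norm, add_sub_cancel_left]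
  have hmem₀ : ((c + s • d, 0) : P × ℝ) ∈ Metric.ball ((c, 0) : P × ℝ) r :=
    hball _ _ (by rwa [hdist]) (by rw [abs_zero]; exact hr)
  -- the sign of `σ (c + s • d, 0)` is the sign of `b`
  have hσ₀ : 0 < ψ (frc d) * σ (c + s • d, 0) := by
    rw [hred _ _ hmem₀, add_sub_cancel_left, frc.map_smul, ψ.map_smul, smul_eq_mul]
    have hz : υ (c + s • d, 0) - u₀ = s • (s⁻¹ • (υ (c + s • d, 0) - u₀)) := by
      rw [smul_smul, mul_inv_cancel₀ hs.ne', one_smul]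
    rw [hz, hQsmul]
    linarith [mul_pos hs hs₃]
  -- hence opposite to the sign of `a`
  have hσ₀' : ψ (B (Dυ (0, 1)) (Dυ (0, 1))) * σ (c + s • d, 0) < 0 := by
    nlinarith [mul_neg_of_neg_of_pos hab hσ₀, mul_self_nonneg (ψ (frc d)),
      mul_self_pos.2 hb]
  exact ⟨s, ξ, hs, by rwa [hdist], hξη, hmem₀, hs₂', hσ₀', hs₂⟩

/-- **Robust crossing at a transversal fold** (the saddle-node / turning point: Kielhöfer 2012
§I.4–I.5; Chow–Hale 1982 Ch. 6; Vanderbauwhede 1982 Ch. 8).  Let `N u = A u + B u u` be a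
continuous quadratic map with linearisation `T = A + B u₀ + B · u₀` at a zero `u₀` of
`N + frc c`, let `ψ` be a cokernel functional (`ψ ∘ T = 0`, `ψ e = 1`), and let `(σ, υ)` be a
Lyapunov–Schmidt family on the ball of radius `r` around `(c, 0)`:
`N (υ q) + frc q.1 − σ q • e = 0`, `υ (c, 0) = u₀`, `υ` differentiable at `(c, 0)` with derivative
`Dυ`, `σ` continuous on the ball.  If the fold coefficient `a = ψ (B g₁ g₁)`, `g₁ = Dυ (0, 1)`, is
nonzero and the direction `d` is visible at first order, `b = ψ (frc d) ≠ 0`, then `σ` changes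
sign in the kernel coordinate at parameters `c + s d` arbitrarily close to `c`: for every `η > 0`
there are `s, x₁, x₂` with `dist (c + s d) c < η`, `|x₁|, |x₂| < η`, both points in the ball, and
`σ (c + s d, x₁) < 0 < σ (c + s d, x₂)`. [folklore] -/
theorem robustCrossing_of_fold (A : X →L[ℝ] Y) (B : X →L[ℝ] X →L[ℝ] Y) (T : X →L[ℝ] Y)
    (frc : P →L[ℝ] Y) (u₀ : X) (c d : P) (e : Y) (ψ : Y →L[ℝ] ℝ) (σ : P × ℝ → ℝ)
    (υ : P × ℝ → X) (Dυ : P × ℝ →L[ℝ] X) (r : ℝ) (hT : ∀ w, T w = A w + B u₀ w + B w u₀)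
    (hψT : ∀ w, ψ (T w) = 0) (hψe : ψ e = 1) (h0 : A u₀ + B u₀ u₀ + frc c = 0) (hr : 0 < r)
    (hυ0 : υ (c, 0) = u₀) (hυd : HasFDerivAt υ Dυ (c, 0))
    (hσc : ContinuousOn σ (Metric.ball ((c, 0) : P × ℝ) r))
    (hsol : ∀ q ∈ Metric.ball ((c, 0) : P × ℝ) r,
      A (υ q) + B (υ q) (υ q) + frc q.1 - σ q • e = 0)
    (ha : ψ (B (Dυ (0, 1)) (Dυ (0, 1))) ≠ 0) (hb : ψ (frc d) ≠ 0) :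
    ∀ η : ℝ, 0 < η → ∃ (s x₁ x₂ : ℝ), dist (c + s • d) c < η ∧ |x₁| < η ∧ |x₂| < η ∧
      ((c + s • d, x₁) : P × ℝ) ∈ Metric.ball ((c, 0) : P × ℝ) r ∧
      ((c + s • d, x₂) : P × ℝ) ∈ Metric.ball ((c, 0) : P × ℝ) r ∧
      σ (c + s • d, x₁) < 0 ∧ 0 < σ (c + s • d, x₂) := by
  intro η hη
  -- normalise the unfolding direction: `d' := κ • d`, `κ := -(a b)`, so that `a · ψ (frc d') < 0`
  have hκ : ψ (B (Dυ (0, 1)) (Dυ (0, 1))) *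
      ψ (frc ((-(ψ (B (Dυ (0, 1)) (Dυ (0, 1))) * ψ (frc d))) • d)) < 0 := by
    rw [frc.map_smul, ψ.map_smul, smul_eq_mul]
    nlinarith [mul_self_pos.2 (mul_ne_zero ha hb)]
  obtain ⟨s, ξ, -, hdist, hξ, hmem₀, hmemξ, hσ₀, hσξ⟩ :=
    robustCrossing_of_fold_of_mul_neg A B T frc u₀ c _ e ψ σ υ Dυ r hT hψT hψe h0 hr hυ0 hυd
      hσc hsol hκ hη
  -- back to the direction `d`: `s • (κ • d) = (s * κ) • d`
  rw [smul_smul] at hdist hmem₀ hmemξ hσ₀ hσξ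
  have hη0 : |(0 : ℝ)| < η := by rwa [abs_zero]
  rcases ha.lt_or_gt with ha' | ha'
  · -- `a < 0`: `σ (·, ξ) < 0 < σ (·, 0)`
    exact ⟨_, ξ, 0, hdist, hξ, hη0, hmemξ, hmem₀, by nlinarith, by nlinarith⟩
  · -- `0 < a`: `σ (·, 0) < 0 < σ (·, ξ)`
    exact ⟨_, 0, ξ, hdist, hη0, hξ, hmem₀, hmemξ, by nlinarith, by nlinarith⟩

end SecondOrder

end Literature.Analysis.Calculus

end
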